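import Summits.BirchSwinnertonDyer.BirchSwinnertonDyer.Theorems.LeadingTermConsistencyOfItems
import HarnessLib

/-!
# BirchSwinnertonDyer / LeadingTerm — crux `Consistency` (stmt-BirchSwinnertonDyer-16217):
# child A (`ConsistencyNonDeficient`) of the strategist split is the diagonal `p`-adic Beilinson identity

Companion of `LeadingTermConsistencySplit` (the exact split `Consistency ↔ ConsistencyNonDeficient ∧
DeficientVanishing`, crux-strategists s1/r1 of stmt-BirchSwinnertonDyer-16217). This file records, with
every item and child spelled out verbatim as a hypothesis, where child A sits:

* `diagonalTwoLe_of_nonDeficient` — child A restricted to the diagonal `r_MW = r_an ≥ 2` is S2, the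
  residual stub `stub_diagonal_two_le` of line `Sketch` (= `stub_diagonal_two` ∧ `stub_diagonal_three_le` of
  line `ladder-rank2`);
* `nonDeficient_of_diagonalTwoLe_of_items`, `nonDeficient_iff_diagonalTwoLe_of_items` — modulo the items
  `SqueezeUBR2` (crux #4: no excess cells) and `RankLeOne` (support: the known ranks `0`, `1`), child A is
  EQUIVALENT to S2;
* `rationality_of_nonDeficient` — child A implies BSD-RATIONALITY at the rank: for `r_MW = r_an ≥ 2` and the
  newform `f` of `E`, `L^{(r)}(E,1) ∈ ℚ · r! · Ω⁺_f · Reg_∞(E)` (archimedean, `p`-free) — refined-BSD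
  content (Tate 1974 Conj. 4(b) modulo `ℚ^×`; Burns–Kurihara–Sano Conj. 1.1(ii)) that the summit statement
  `BirchSwinnertonDyer` (rank equality) does NOT imply: child A is the beyond-summit SURPLUS of the crux,
  and it is not consumed by the route's deciding theorem (see `LeadingTermConsistencyBypass`);
* `nonDeficient_of_rationality_of_transfer_of_items` — conversely (R) ∧ (T) (the two stubs of line `birth`)
  give child A modulo the same two items, so `birth` is a skeleton of child A.

References: Mazur–Tate–Teitelbaum, Invent. Math. 84 (1986) §I.14; Perrin-Riou, Invent. Math. 89 (1987)
§1.4; Burns–Kurihara–Sano (BurnsKuriharaSano2019) Conj. 1.1, Thm 1.8, Cor. 1.10.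
-/

set_option linter.dupNamespace false

namespace Summit.BirchSwinnertonDyer.BirchSwinnertonDyer.Theorems

open scoped MatrixGroups ModularForm
open CongruenceSubgroup Literature.NumberTheory.EllipticCurves
  Literature.NumberTheory.EllipticCurves.ModularForms WeierstrassCurve
open Summit.BirchSwinnertonDyer.BirchSwinnertonDyer.Theses.LeadingTerm (Consistency SqueezeUBR2 RankLeOne)

/-! ### Child A is the diagonal `p`-adic Beilinson identity: modulo items it is S2 = (R) ∧ (T) -/

/-- **`ConsistencyNonDeficient → S2`** (restriction to the diagonal `r_MW = r_an ≥ 2`; S2 = the registered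
stub `stub_diagonal_two_le` of line `Sketch` verbatim). [folklore] -/
theorem diagonalTwoLe_of_nonDeficient :
    (∀ (W : WeierstrassCurve ℚ) [W.IsElliptic] [W.IsGloballyMinimal] (p : ℕ) [Fact p.Prime],
      5 ≤ p → Literature.NumberTheory.EllipticCurves.IsOrdinaryAt W p →
      ∀ (D : WeierstrassCurve.PAdicHeightData W p), D.IsCanonical →
      ∀ ⦃N : ℕ⦄ [NeZero N] (f : CuspForm (CongruenceSubgroup.Gamma0 N) 2),
        Literature.NumberTheory.EllipticCurves.ModularForms.IsNewformOf W f →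
        W.analyticRank ≤ W.mordellWeilRank →
          0 < W.regulator ∧ 0 < Literature.NumberTheory.EllipticCurves.ModularForms.plusPeriod f ∧
          ∃ q : ℚ, iteratedDeriv W.mordellWeilRank W.entireLFunction 1 =
              (((W.mordellWeilRank.factorial : ℝ) * (q : ℝ) *
                Literature.NumberTheory.EllipticCurves.ModularForms.plusPeriod f * W.regulator : ℝ) : ℂ) ∧
            PowerSeries.coeff W.mordellWeilRank
                (Literature.NumberTheory.EllipticCurves.padicLFunction f
                  (Literature.NumberTheory.EllipticCurves.unitRoot W p : ℚ_[p])) *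
                Literature.NumberTheory.EllipticCurves.padicLog p
                  (Literature.NumberTheory.EllipticCurves.cyclotomicGenerator p) ^ W.mordellWeilRank =
              (q : ℚ_[p]) * (1 - (Literature.NumberTheory.EllipticCurves.unitRoot W p : ℚ_[p])⁻¹) ^ 2 *
                WeierstrassCurve.padicRegulator D) →
    ∀ (W : WeierstrassCurve ℚ) [W.IsElliptic] [W.IsGloballyMinimal] (p : ℕ) [Fact p.Prime],
      5 ≤ p → Literature.NumberTheory.EllipticCurves.IsOrdinaryAt W p →
      ∀ (D : WeierstrassCurve.PAdicHeightData W p), D.IsCanonical →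
      ∀ ⦃N : ℕ⦄ [NeZero N] (f : CuspForm (CongruenceSubgroup.Gamma0 N) 2),
        Literature.NumberTheory.EllipticCurves.ModularForms.IsNewformOf W f →
        2 ≤ W.mordellWeilRank → W.analyticRank = W.mordellWeilRank →
          0 < W.regulator ∧ 0 < Literature.NumberTheory.EllipticCurves.ModularForms.plusPeriod f ∧
          ∃ q : ℚ, iteratedDeriv W.mordellWeilRank W.entireLFunction 1 =
              (((W.mordellWeilRank.factorial : ℝ) * (q : ℝ) *
                Literature.NumberTheory.EllipticCurves.ModularForms.plusPeriod f * W.regulator : ℝ) : ℂ) ∧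
            PowerSeries.coeff W.mordellWeilRank
                (Literature.NumberTheory.EllipticCurves.padicLFunction f
                  (Literature.NumberTheory.EllipticCurves.unitRoot W p : ℚ_[p])) *
                Literature.NumberTheory.EllipticCurves.padicLog p
                  (Literature.NumberTheory.EllipticCurves.cyclotomicGenerator p) ^ W.mordellWeilRank =
              (q : ℚ_[p]) * (1 - (Literature.NumberTheory.EllipticCurves.unitRoot W p : ℚ_[p])⁻¹) ^ 2 *
                WeierstrassCurve.padicRegulator D :=
  fun hA W _ _ p _ h5 hord D hD _ _ f hf _ heq => hA W p h5 hord D hD f hf heq.le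

/-- **S2 → `ConsistencyNonDeficient` modulo the items `SqueezeUBR2` (crux #4) and `RankLeOne` (support)**:
no excess cells (`SqueezeUBR2`), so `r_an ≤ r_MW` is the diagonal; there `r = 0` is the tree theorem
`leadingTerm_consistency_of_rank_zero`, `r = 1` is `RankLeOne`, `r ≥ 2` is S2.
[cite: MazurTateTeitelbaum1986Invent, §I.14 (14.3)] -/
theorem nonDeficient_of_diagonalTwoLe_of_items :
    (∀ (W : WeierstrassCurve ℚ) [W.IsElliptic] [W.IsGloballyMinimal] (p : ℕ) [Fact p.Prime],
      5 ≤ p → Literature.NumberTheory.EllipticCurves.IsOrdinaryAt W p →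
      ∀ (D : WeierstrassCurve.PAdicHeightData W p), D.IsCanonical →
      ∀ ⦃N : ℕ⦄ [NeZero N] (f : CuspForm (CongruenceSubgroup.Gamma0 N) 2),
        Literature.NumberTheory.EllipticCurves.ModularForms.IsNewformOf W f →
        2 ≤ W.mordellWeilRank → W.analyticRank = W.mordellWeilRank →
          0 < W.regulator ∧ 0 < Literature.NumberTheory.EllipticCurves.ModularForms.plusPeriod f ∧
          ∃ q : ℚ, iteratedDeriv W.mordellWeilRank W.entireLFunction 1 =
              (((W.mordellWeilRank.factorial : ℝ) * (q : ℝ) *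
                Literature.NumberTheory.EllipticCurves.ModularForms.plusPeriod f * W.regulator : ℝ) : ℂ) ∧
            PowerSeries.coeff W.mordellWeilRank
                (Literature.NumberTheory.EllipticCurves.padicLFunction f
                  (Literature.NumberTheory.EllipticCurves.unitRoot W p : ℚ_[p])) *
                Literature.NumberTheory.EllipticCurves.padicLog p
                  (Literature.NumberTheory.EllipticCurves.cyclotomicGenerator p) ^ W.mordellWeilRank =
              (q : ℚ_[p]) * (1 - (Literature.NumberTheory.EllipticCurves.unitRoot W p : ℚ_[p])⁻¹) ^ 2 *
                WeierstrassCurve.padicRegulator D) →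
    Summit.BirchSwinnertonDyer.BirchSwinnertonDyer.Theses.LeadingTerm.SqueezeUBR2 →
    Summit.BirchSwinnertonDyer.BirchSwinnertonDyer.Theses.LeadingTerm.RankLeOne →
    ∀ (W : WeierstrassCurve ℚ) [W.IsElliptic] [W.IsGloballyMinimal] (p : ℕ) [Fact p.Prime],
      5 ≤ p → Literature.NumberTheory.EllipticCurves.IsOrdinaryAt W p →
      ∀ (D : WeierstrassCurve.PAdicHeightData W p), D.IsCanonical →
      ∀ ⦃N : ℕ⦄ [NeZero N] (f : CuspForm (CongruenceSubgroup.Gamma0 N) 2),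
        Literature.NumberTheory.EllipticCurves.ModularForms.IsNewformOf W f →
        W.analyticRank ≤ W.mordellWeilRank →
          0 < W.regulator ∧ 0 < Literature.NumberTheory.EllipticCurves.ModularForms.plusPeriod f ∧
          ∃ q : ℚ, iteratedDeriv W.mordellWeilRank W.entireLFunction 1 =
              (((W.mordellWeilRank.factorial : ℝ) * (q : ℝ) *
                Literature.NumberTheory.EllipticCurves.ModularForms.plusPeriod f * W.regulator : ℝ) : ℂ) ∧
            PowerSeries.coeff W.mordellWeilRank
                (Literature.NumberTheory.EllipticCurves.padicLFunction f
                  (Literature.NumberTheory.EllipticCurves.unitRoot W p : ℚ_[p])) *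
                Literature.NumberTheory.EllipticCurves.padicLog p
                  (Literature.NumberTheory.EllipticCurves.cyclotomicGenerator p) ^ W.mordellWeilRank =
              (q : ℚ_[p]) * (1 - (Literature.NumberTheory.EllipticCurves.unitRoot W p : ℚ_[p])⁻¹) ^ 2 *
                WeierstrassCurve.padicRegulator D := by
  intro hS2 hUB hR1 W _ _ p _ h5 hord D hD N _ f hf hle
  have heq : W.analyticRank = W.mordellWeilRank := le_antisymm hle (hUB W)
  rcases Nat.eq_zero_or_pos W.mordellWeilRank with h0 | hpos
  · exact leadingTerm_consistency_of_rank_zero W p hord h0 D f hf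
  · by_cases h1 : W.mordellWeilRank = 1
    · exact hR1 W p h5 hord h1.le heq D hD f hf
    · exact hS2 W p h5 hord D hD f hf (by omega) heq

/-- **Modulo `SqueezeUBR2` and `RankLeOne`, child A is EQUIVALENT to S2** (the residual stub of lines
`Sketch` / `birth`). [folklore] -/
theorem nonDeficient_iff_diagonalTwoLe_of_items :
    Summit.BirchSwinnertonDyer.BirchSwinnertonDyer.Theses.LeadingTerm.SqueezeUBR2 →
    Summit.BirchSwinnertonDyer.BirchSwinnertonDyer.Theses.LeadingTerm.RankLeOne →
    ((∀ (W : WeierstrassCurve ℚ) [W.IsElliptic] [W.IsGloballyMinimal] (p : ℕ) [Fact p.Prime],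
      5 ≤ p → Literature.NumberTheory.EllipticCurves.IsOrdinaryAt W p →
      ∀ (D : WeierstrassCurve.PAdicHeightData W p), D.IsCanonical →
      ∀ ⦃N : ℕ⦄ [NeZero N] (f : CuspForm (CongruenceSubgroup.Gamma0 N) 2),
        Literature.NumberTheory.EllipticCurves.ModularForms.IsNewformOf W f →
        W.analyticRank ≤ W.mordellWeilRank →
          0 < W.regulator ∧ 0 < Literature.NumberTheory.EllipticCurves.ModularForms.plusPeriod f ∧
          ∃ q : ℚ, iteratedDeriv W.mordellWeilRank W.entireLFunction 1 =
              (((W.mordellWeilRank.factorial : ℝ) * (q : ℝ) *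
                Literature.NumberTheory.EllipticCurves.ModularForms.plusPeriod f * W.regulator : ℝ) : ℂ) ∧
            PowerSeries.coeff W.mordellWeilRank
                (Literature.NumberTheory.EllipticCurves.padicLFunction f
                  (Literature.NumberTheory.EllipticCurves.unitRoot W p : ℚ_[p])) *
                Literature.NumberTheory.EllipticCurves.padicLog p
                  (Literature.NumberTheory.EllipticCurves.cyclotomicGenerator p) ^ W.mordellWeilRank =
              (q : ℚ_[p]) * (1 - (Literature.NumberTheory.EllipticCurves.unitRoot W p : ℚ_[p])⁻¹) ^ 2 *
                WeierstrassCurve.padicRegulator D) ↔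
     (∀ (W : WeierstrassCurve ℚ) [W.IsElliptic] [W.IsGloballyMinimal] (p : ℕ) [Fact p.Prime],
      5 ≤ p → Literature.NumberTheory.EllipticCurves.IsOrdinaryAt W p →
      ∀ (D : WeierstrassCurve.PAdicHeightData W p), D.IsCanonical →
      ∀ ⦃N : ℕ⦄ [NeZero N] (f : CuspForm (CongruenceSubgroup.Gamma0 N) 2),
        Literature.NumberTheory.EllipticCurves.ModularForms.IsNewformOf W f →
        2 ≤ W.mordellWeilRank → W.analyticRank = W.mordellWeilRank →
          0 < W.regulator ∧ 0 < Literature.NumberTheory.EllipticCurves.ModularForms.plusPeriod f ∧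
          ∃ q : ℚ, iteratedDeriv W.mordellWeilRank W.entireLFunction 1 =
              (((W.mordellWeilRank.factorial : ℝ) * (q : ℝ) *
                Literature.NumberTheory.EllipticCurves.ModularForms.plusPeriod f * W.regulator : ℝ) : ℂ) ∧
            PowerSeries.coeff W.mordellWeilRank
                (Literature.NumberTheory.EllipticCurves.padicLFunction f
                  (Literature.NumberTheory.EllipticCurves.unitRoot W p : ℚ_[p])) *
                Literature.NumberTheory.EllipticCurves.padicLog p
                  (Literature.NumberTheory.EllipticCurves.cyclotomicGenerator p) ^ W.mordellWeilRank =
              (q : ℚ_[p]) * (1 - (Literature.NumberTheory.EllipticCurves.unitRoot W p : ℚ_[p])⁻¹) ^ 2 *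
                WeierstrassCurve.padicRegulator D)) :=
  fun hUB hR1 => ⟨fun hA => diagonalTwoLe_of_nonDeficient hA,
    fun hS2 => nonDeficient_of_diagonalTwoLe_of_items hS2 hUB hR1⟩

/-- **Child A contains BSD-RATIONALITY at the rank** (archimedean, `p`-free; refined-BSD content beyond the
summit): for `r_MW = r_an ≥ 2` and the newform `f` of `E`, `L^{(r)}(E,1) ∈ ℚ · r! · Ω⁺_f · Reg_∞(E)` — via
`diagonalTwoLe_of_nonDeficient` and the landed `diagonalTwoLe_iff_rationality_and_transfer` (p134366; a good
ordinary `p ≥ 5` and a canonical datum always exist). [cite: BurnsKuriharaSano2019, Conj. 1.1] -/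
theorem rationality_of_nonDeficient :
    (∀ (W : WeierstrassCurve ℚ) [W.IsElliptic] [W.IsGloballyMinimal] (p : ℕ) [Fact p.Prime],
      5 ≤ p → Literature.NumberTheory.EllipticCurves.IsOrdinaryAt W p →
      ∀ (D : WeierstrassCurve.PAdicHeightData W p), D.IsCanonical →
      ∀ ⦃N : ℕ⦄ [NeZero N] (f : CuspForm (CongruenceSubgroup.Gamma0 N) 2),
        Literature.NumberTheory.EllipticCurves.ModularForms.IsNewformOf W f →
        W.analyticRank ≤ W.mordellWeilRank →
          0 < W.regulator ∧ 0 < Literature.NumberTheory.EllipticCurves.ModularForms.plusPeriod f ∧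
          ∃ q : ℚ, iteratedDeriv W.mordellWeilRank W.entireLFunction 1 =
              (((W.mordellWeilRank.factorial : ℝ) * (q : ℝ) *
                Literature.NumberTheory.EllipticCurves.ModularForms.plusPeriod f * W.regulator : ℝ) : ℂ) ∧
            PowerSeries.coeff W.mordellWeilRank
                (Literature.NumberTheory.EllipticCurves.padicLFunction f
                  (Literature.NumberTheory.EllipticCurves.unitRoot W p : ℚ_[p])) *
                Literature.NumberTheory.EllipticCurves.padicLog p
                  (Literature.NumberTheory.EllipticCurves.cyclotomicGenerator p) ^ W.mordellWeilRank =
              (q : ℚ_[p]) * (1 - (Literature.NumberTheory.EllipticCurves.unitRoot W p : ℚ_[p])⁻¹) ^ 2 *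
                WeierstrassCurve.padicRegulator D) →
    ∀ (W : WeierstrassCurve ℚ) [W.IsElliptic] [W.IsGloballyMinimal]
      ⦃N : ℕ⦄ [NeZero N] (f : CuspForm (CongruenceSubgroup.Gamma0 N) 2),
      Literature.NumberTheory.EllipticCurves.ModularForms.IsNewformOf W f →
      2 ≤ W.mordellWeilRank → W.analyticRank = W.mordellWeilRank →
        ∃ q : ℚ, iteratedDeriv W.mordellWeilRank W.entireLFunction 1 =
          (((W.mordellWeilRank.factorial : ℝ) * (q : ℝ) *
            Literature.NumberTheory.EllipticCurves.ModularForms.plusPeriod f * W.regulator : ℝ) : ℂ) :=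
  fun hA => (diagonalTwoLe_iff_rationality_and_transfer.mp (diagonalTwoLe_of_nonDeficient hA)).1

/-- **Conversely (R) ∧ (T) give child A modulo `SqueezeUBR2` and `RankLeOne`** — so the two stubs of line
`birth` (`stub_rationality`, `stub_transfer`) are a skeleton of child A as well. [folklore] -/
theorem nonDeficient_of_rationality_of_transfer_of_items :
    (∀ (W : WeierstrassCurve ℚ) [W.IsElliptic] [W.IsGloballyMinimal]
        ⦃N : ℕ⦄ [NeZero N] (f : CuspForm (CongruenceSubgroup.Gamma0 N) 2),
        Literature.NumberTheory.EllipticCurves.ModularForms.IsNewformOf W f →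
        2 ≤ W.mordellWeilRank → W.analyticRank = W.mordellWeilRank →
          ∃ q : ℚ, iteratedDeriv W.mordellWeilRank W.entireLFunction 1 =
            (((W.mordellWeilRank.factorial : ℝ) * (q : ℝ) *
              Literature.NumberTheory.EllipticCurves.ModularForms.plusPeriod f * W.regulator : ℝ) : ℂ)) →
    (∀ (W : WeierstrassCurve ℚ) [W.IsElliptic] [W.IsGloballyMinimal] (p : ℕ) [Fact p.Prime],
      5 ≤ p → Literature.NumberTheory.EllipticCurves.IsOrdinaryAt W p →
      ∀ (D : WeierstrassCurve.PAdicHeightData W p), D.IsCanonical →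
      ∀ ⦃N : ℕ⦄ [NeZero N] (f : CuspForm (CongruenceSubgroup.Gamma0 N) 2),
        Literature.NumberTheory.EllipticCurves.ModularForms.IsNewformOf W f →
        2 ≤ W.mordellWeilRank → W.analyticRank = W.mordellWeilRank → ∀ q : ℚ,
          iteratedDeriv W.mordellWeilRank W.entireLFunction 1 =
              (((W.mordellWeilRank.factorial : ℝ) * (q : ℝ) *
                Literature.NumberTheory.EllipticCurves.ModularForms.plusPeriod f * W.regulator : ℝ) : ℂ) →
            PowerSeries.coeff W.mordellWeilRank
                (Literature.NumberTheory.EllipticCurves.padicLFunction f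
                  (Literature.NumberTheory.EllipticCurves.unitRoot W p : ℚ_[p])) *
                Literature.NumberTheory.EllipticCurves.padicLog p
                  (Literature.NumberTheory.EllipticCurves.cyclotomicGenerator p) ^ W.mordellWeilRank =
              (q : ℚ_[p]) * (1 - (Literature.NumberTheory.EllipticCurves.unitRoot W p : ℚ_[p])⁻¹) ^ 2 *
                WeierstrassCurve.padicRegulator D) →
    Summit.BirchSwinnertonDyer.BirchSwinnertonDyer.Theses.LeadingTerm.SqueezeUBR2 →
    Summit.BirchSwinnertonDyer.BirchSwinnertonDyer.Theses.LeadingTerm.RankLeOne →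
    ∀ (W : WeierstrassCurve ℚ) [W.IsElliptic] [W.IsGloballyMinimal] (p : ℕ) [Fact p.Prime],
      5 ≤ p → Literature.NumberTheory.EllipticCurves.IsOrdinaryAt W p →
      ∀ (D : WeierstrassCurve.PAdicHeightData W p), D.IsCanonical →
      ∀ ⦃N : ℕ⦄ [NeZero N] (f : CuspForm (CongruenceSubgroup.Gamma0 N) 2),
        Literature.NumberTheory.EllipticCurves.ModularForms.IsNewformOf W f →
        W.analyticRank ≤ W.mordellWeilRank →
          0 < W.regulator ∧ 0 < Literature.NumberTheory.EllipticCurves.ModularForms.plusPeriod f ∧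
          ∃ q : ℚ, iteratedDeriv W.mordellWeilRank W.entireLFunction 1 =
              (((W.mordellWeilRank.factorial : ℝ) * (q : ℝ) *
                Literature.NumberTheory.EllipticCurves.ModularForms.plusPeriod f * W.regulator : ℝ) : ℂ) ∧
            PowerSeries.coeff W.mordellWeilRank
                (Literature.NumberTheory.EllipticCurves.padicLFunction f
                  (Literature.NumberTheory.EllipticCurves.unitRoot W p : ℚ_[p])) *
                Literature.NumberTheory.EllipticCurves.padicLog p
                  (Literature.NumberTheory.EllipticCurves.cyclotomicGenerator p) ^ W.mordellWeilRank =
              (q : ℚ_[p]) * (1 - (Literature.NumberTheory.EllipticCurves.unitRoot W p : ℚ_[p])⁻¹) ^ 2 *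
                WeierstrassCurve.padicRegulator D :=
  fun hR hT hUB hR1 => nonDeficient_of_diagonalTwoLe_of_items
    (diagonalTwoLe_iff_rationality_and_transfer.mpr ⟨hR, hT⟩) hUB hR1

end Summit.BirchSwinnertonDyer.BirchSwinnertonDyer.Theorems
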